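import Literature.NumberTheory.Transcendental.ThetaMorphic
import Literature.NumberTheory.Transcendental.PkappaThetaLaws
import HarnessLib

/-!
# The elementary transvection of the `E`-coordinates is `Θ`-morphic

Topic: `Literature/NumberTheory/Transcendental`. A brick of the discharge of the named fact
`Literature.NumberTheory.Transcendental.philippon1986_std` (classification of the obstruction
subgroups of Philippon's zero estimate on `M_κ = 𝔾ₘ^β × P_κ`, general number of elliptic
factors): the isomorphism of algebraic groups `M_κ ≅ M_{κ'}` induced by the integer change of
coordinates `z'_{b₁} ↦ z'_{b₁} + z'_{b₂}` of `Lie E^γ` (with `κ'_{·b₂} = κ_{·b₂} - κ_{·b₁}`, all other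
data unchanged) is `Θ`-MORPHIC in the sense of `ThetaMorphic.lean`: locally, the theta functions
of `M_{κ'}` at the new point are forms of degree `3` in the theta functions of `M_κ` at the old
point (`GaGmE.Std.isThetaMorphic_transvection`).

Off the diagonal `z'_{b₁} ≡ z'_{b₂} (mod Λ)` the forms are written down from the chord law of the
cubic and its `ζ`-companion (`UnivExtThetaAddition.lean`: `A_i(P(z₁), P(z₂)) = μ P_i(z₁ + z₂)`,
`B_i(P(z₂); Z(z₁), P(z₁)) - B_i(P(z₁); Z(z₂), P(z₂)) + C_i = μ Z_i(z₁ + z₂)`, `μ = -σ(z₁ - z₂)³`):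
with a chart `K` of non-vanishing blocks at the point and the unit
`u = μ · P_{K b₁}(z₁) · ∏_{b ∉ {b₁,b₂}} P_{K b}(z_b)²`,

* `u · Θ'_{(a,(N,∅))} = ∑ a^{(N b₁)}_{jk;lm} X_{(a,(Ñ,∅))} X_{(∅,(K⟨j,l⟩,∅))} X_{(∅,(K⟨k,m⟩,∅))}`,
  `Ñ = N[b₁ ↦ K b₁]`, `K⟨j,l⟩ = K[b₁ ↦ j, b₂ ↦ l]` (`a` the chord tensor `chordCoeff₂`);
* `u · Θ'_{(a,(N,e))} =` the same with `X_{(a,(Ñ,e))}` `+ κ_{e b₁} ·` a PURE cubic form: giving the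
  fibre factor `s_e` to the theta of chart `Ñ` makes the companion terms of the blocks `b₂` and
  `b ∉ {b₁, b₂}` cancel exactly, and the remaining `κ_{e b₁}`-term
  `A Z_{K₁}(z₁) P_{N₂}(z₂) - B P_{K₁}(z₁) P_{N₂}(z₂) + A P_{K₁}(z₁) Z_{N₂}(z₂)` is the pure expression
  `∑ α_{jk}(P z₂) P_k(z₁) ρ_{jK₁}(P z₁) P_{N₂}(z₂) - P_{K₁}(z₁) ∑ α_{jk}(P z₁) P_k(z₂) ρ_{jN₂}(P z₂)
   - C(P z₁, P z₂) P_{K₁}(z₁) P_{N₂}(z₂)` by the antisymmetry of the chord law and the block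
  relations `P_j Z_k - Z_j P_k = ρ_{jk}(P)` (`PkappaThetaBlockRelations.lean`) — Step
  `transvection_identity`.

On the diagonal the transvection is the composite of a translation, the transvection at a point
off the diagonal, and a translation back (`ThetaMorphic.isThetaMorphic_add_const`).
Everything is PROVED; the definitions are the new `κ`, the map, the charts with two entries
replaced, the block-relation table and the explicit forms.

## References

* Yu. V. Nesterenko, P. Philippon (eds.), *Introduction to Algebraic Independence Theory*,
  LNM 1752, Springer 2001, Ch. 11 (D. Roy), §2.1. [NesterenkoPhilippon2001]
* D. Bertrand, P. Philippon, *Sous-groupes algébriques de groupes algébriques commutatifs*,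
  Illinois J. Math. 32 (1988), 263–280. [folklore]
* E. T. Whittaker, G. N. Watson, *A Course of Modern Analysis*, 4th ed., CUP 1927, §20.22,
  §20.41 (addition theorems). [WhittakerWatson1927]
-/

noncomputable section

open Complex MvPolynomial
open scoped PeriodPair

namespace Literature.NumberTheory.Transcendental

variable (L : PeriodPair)

/-! ### The block relations as a table -/

/-- The quadratic forms `ρ_{jk}` with `P_j Z_k - Z_j P_k = ρ_{jk}(P)`:
`ρ_{02} = 2x₁²`, `ρ_{20} = -2x₁²`, `ρ_{12} = (x₂² + g₂x₀x₁ + g₃x₀²)/2`, `ρ_{21} = -ρ_{12}`, else `0`.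
[cite: WhittakerWatson1927, §20.22] -/
def _root_.PeriodPair.blockRel (j k : Fin 3) (x : Fin 3 → ℂ) : ℂ :=
  if j = 0 ∧ k = 2 then 2 * x 1 ^ 2 else
  if j = 2 ∧ k = 0 then -(2 * x 1 ^ 2) else
  if j = 1 ∧ k = 2 then (x 2 ^ 2 + L.g₂ * x 0 * x 1 + L.g₃ * x 0 ^ 2) / 2 else
  if j = 2 ∧ k = 1 then -((x 2 ^ 2 + L.g₂ * x 0 * x 1 + L.g₃ * x 0 ^ 2) / 2) else 0

/-- **The block relations**: `P_j(z) Z_k(z) - Z_j(z) P_k(z) = ρ_{jk}(P(z))` for all `z`.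
[cite: WhittakerWatson1927, §20.22] -/
theorem _root_.PeriodPair.univExtP_mul_univExtZ_sub (j k : Fin 3) (z : ℂ) :
    L.univExtP j z * L.univExtZ k z - L.univExtZ j z * L.univExtP k z =
      L.blockRel j k fun i => L.univExtP i z := by
  have h01 := L.univExtZ_zero_mul_univExtP_one z
  have h02 := L.univExtZ_zero_mul_univExtP_two_sub z
  have h12 := L.two_mul_univExtZ_one_mul_univExtP_two_sub z
  have hj : j = 0 ∨ j = 1 ∨ j = 2 := by fin_cases j <;> simp
  have hk : k = 0 ∨ k = 1 ∨ k = 2 := by fin_cases k <;> simp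
  rcases hj with rfl | rfl | rfl <;> rcases hk with rfl | rfl | rfl <;>
    simp +decide only [PeriodPair.blockRel, reduceIte]
  · ring
  · linear_combination -h01
  · linear_combination -h02
  · linear_combination h01
  · ring
  · linear_combination (-1 / 2 : ℂ) * h12
  · linear_combination h02
  · linear_combination (1 / 2 : ℂ) * h12
  · ring

namespace GaGmE

namespace Std

variable {β γ δ : Type} [Fintype β] [Fintype γ] [Fintype δ] [DecidableEq γ]
variable (κM : δ → γ → Kbar) {b₁ b₂ : γ} (h12 : b₁ ≠ b₂)

/-! ### Splitting products and sums over the blocks at `b₁, b₂` -/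

/-- The blocks other than `b₁, b₂`. [folklore] -/
def rest (b₁ b₂ : γ) : Finset γ := (Finset.univ.erase b₁).erase b₂

omit [Fintype β] [Fintype δ] in
/-- Membership in the rest. [folklore] -/
theorem mem_rest_iff {b : γ} : b ∈ rest b₁ b₂ ↔ b ≠ b₁ ∧ b ≠ b₂ := by
  simp [rest, and_comm]

omit [Fintype β] [Fintype δ] in
include h12 in
/-- `∏_b g = g b₁ · g b₂ · ∏_{rest} g`. [folklore] -/
theorem prod_split2 (g : γ → ℂ) : ∏ b, g b = g b₁ * g b₂ * ∏ b ∈ rest b₁ b₂, g b := by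
  have h2 : b₂ ∈ Finset.univ.erase b₁ := Finset.mem_erase.mpr ⟨h12.symm, Finset.mem_univ _⟩
  rw [← Finset.mul_prod_erase Finset.univ g (Finset.mem_univ b₁),
    ← Finset.mul_prod_erase (Finset.univ.erase b₁) g h2, rest, mul_assoc]

omit [Fintype β] [Fintype δ] in
include h12 in
/-- `∑_b g = g b₁ + g b₂ + ∑_{rest} g`. [folklore] -/
theorem sum_split2 (g : γ → ℂ) : ∑ b, g b = g b₁ + g b₂ + ∑ b ∈ rest b₁ b₂, g b := by
  have h2 : b₂ ∈ Finset.univ.erase b₁ := Finset.mem_erase.mpr ⟨h12.symm, Finset.mem_univ _⟩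
  rw [← Finset.add_sum_erase Finset.univ g (Finset.mem_univ b₁),
    ← Finset.add_sum_erase (Finset.univ.erase b₁) g h2, rest, add_assoc]

omit [Fintype β] [Fintype δ] in
include h12 in
/-- `∏_{b ≠ b₁} g = g b₂ · ∏_{rest} g`. [folklore] -/
theorem prod_erase_fst (g : γ → ℂ) : ∏ b ∈ Finset.univ.erase b₁, g b = g b₂ * ∏ b ∈ rest b₁ b₂, g b := by
  have h2 : b₂ ∈ Finset.univ.erase b₁ := Finset.mem_erase.mpr ⟨h12.symm, Finset.mem_univ _⟩
  rw [← Finset.mul_prod_erase (Finset.univ.erase b₁) g h2, rest]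

omit [Fintype β] [Fintype δ] in
include h12 in
/-- `∏_{b ≠ b₂} g = g b₁ · ∏_{rest} g`. [folklore] -/
theorem prod_erase_snd (g : γ → ℂ) : ∏ b ∈ Finset.univ.erase b₂, g b = g b₁ * ∏ b ∈ rest b₁ b₂, g b := by
  have h1 : b₁ ∈ Finset.univ.erase b₂ := Finset.mem_erase.mpr ⟨h12, Finset.mem_univ _⟩
  rw [← Finset.mul_prod_erase (Finset.univ.erase b₂) g h1, rest, Finset.erase_right_comm]

omit [Fintype β] [Fintype δ] in
include h12 in
/-- `∏_{b' ≠ b} g = g b₁ · g b₂ · ∏_{rest ∖ b} g` for `b` in the rest. [folklore] -/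
theorem prod_erase_of_mem_rest (g : γ → ℂ) {b : γ} (hb : b ∈ rest b₁ b₂) :
    ∏ b' ∈ Finset.univ.erase b, g b' = g b₁ * g b₂ * ∏ b' ∈ (rest b₁ b₂).erase b, g b' := by
  obtain ⟨hb1, hb2⟩ := mem_rest_iff.mp hb
  have h1 : b₁ ∈ Finset.univ.erase b := Finset.mem_erase.mpr ⟨hb1.symm, Finset.mem_univ _⟩
  have h2 : b₂ ∈ (Finset.univ.erase b).erase b₁ :=
    Finset.mem_erase.mpr ⟨h12.symm, Finset.mem_erase.mpr ⟨hb2.symm, Finset.mem_univ _⟩⟩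
  have hs : ((Finset.univ.erase b).erase b₁).erase b₂ = (rest b₁ b₂).erase b := by
    ext x
    simp only [rest, Finset.mem_erase, Finset.mem_univ, and_true]
    tauto
  rw [← Finset.mul_prod_erase (Finset.univ.erase b) g h1,
    ← Finset.mul_prod_erase ((Finset.univ.erase b).erase b₁) g h2, hs, mul_assoc]

/-! ### Charts with the entries at `b₁, b₂` replaced -/

/-- `M⟨i, i'⟩ = M[b₁ ↦ i, b₂ ↦ i']`. [folklore] -/
def upd2 (b₁ b₂ : γ) (M : γ → Fin 3) (i i' : Fin 3) : γ → Fin 3 :=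
  Function.update (Function.update M b₂ i') b₁ i

omit [Fintype β] [Fintype γ] [Fintype δ] in
/-- The first replaced entry. [folklore] -/
@[simp] theorem upd2_fst (M : γ → Fin 3) (i i' : Fin 3) : upd2 b₁ b₂ M i i' b₁ = i := by
  simp [upd2]

omit [Fintype β] [Fintype γ] [Fintype δ] in
include h12 in
/-- The second replaced entry. [folklore] -/
@[simp] theorem upd2_snd (M : γ → Fin 3) (i i' : Fin 3) : upd2 b₁ b₂ M i i' b₂ = i' := by
  simp [upd2, h12.symm]

omit [Fintype β] [Fintype δ] in
/-- The other entries are unchanged. [folklore] -/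
theorem upd2_of_mem_rest (M : γ → Fin 3) (i i' : Fin 3) {b : γ} (hb : b ∈ rest b₁ b₂) :
    upd2 b₁ b₂ M i i' b = M b := by
  obtain ⟨hb1, hb2⟩ := mem_rest_iff.mp hb
  simp [upd2, hb1, hb2]

omit [Fintype β] [Fintype δ] in
include h12 in
/-- A product over a chart with two entries replaced. [folklore] -/
theorem prod_upd2 (f : γ → Fin 3 → ℂ) (M : γ → Fin 3) (i i' : Fin 3) :
    ∏ b, f b (upd2 b₁ b₂ M i i' b) = f b₁ i * f b₂ i' * ∏ b ∈ rest b₁ b₂, f b (M b) := by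
  rw [prod_split2 h12, upd2_fst, upd2_snd h12]
  congr 1
  exact Finset.prod_congr rfl fun b hb => by rw [upd2_of_mem_rest M i i' hb]

omit [Fintype β] [Fintype δ] in
include h12 in
/-- Replacing the entries by themselves. [folklore] -/
theorem upd2_self (M : γ → Fin 3) : upd2 b₁ b₂ M (M b₁) (M b₂) = M := by
  funext b
  by_cases hb1 : b = b₁
  · subst hb1; simp
  by_cases hb2 : b = b₂
  · subst hb2; simp [h12]
  · exact upd2_of_mem_rest M _ _ (mem_rest_iff.mpr ⟨hb1, hb2⟩)

/-! ### The transvection and the new `κ` -/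

/-- `κ'`: `κ'_{e b₂} = κ_{e b₂} - κ_{e b₁}`, other entries unchanged — the datum of the group
`M_{κ'} ≅ M_κ` under `z'_{b₁} ↦ z'_{b₁} + z'_{b₂}`. [folklore] -/
def tvKappa (b₁ b₂ : γ) : δ → γ → Kbar := fun e b => if b = b₂ then κM e b₂ - κM e b₁ else κM e b

/-- The transvection `z'_{b₁} ↦ z'_{b₁} + z'_{b₂}` of `Lie M_κ,ℂ` (all other coordinates fixed).
[folklore] -/
def tvMap (b₁ b₂ : γ) (w : β ⊕ (γ ⊕ δ) → ℂ) : β ⊕ (γ ⊕ δ) → ℂ :=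
  coords (fun j => w (iy j)) (fun b => if b = b₁ then w (iz b₁) + w (iz b₂) else w (iz b)) fun e => w (is e)

omit [Fintype β] [Fintype γ] [Fintype δ] in
/-- The new first coordinate. [folklore] -/
@[simp] theorem tvMap_iz_fst (w : β ⊕ (γ ⊕ δ) → ℂ) : tvMap b₁ b₂ w (iz b₁) = w (iz b₁) + w (iz b₂) := by
  simp [tvMap]

omit [Fintype β] [Fintype γ] [Fintype δ] in
/-- The other `E`-coordinates are fixed. [folklore] -/
theorem tvMap_iz_of_ne {b : γ} (hb : b ≠ b₁) (w : β ⊕ (γ ⊕ δ) → ℂ) : tvMap b₁ b₂ w (iz b) = w (iz b) := by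
  simp [tvMap, hb]

omit [Fintype β] [Fintype γ] [Fintype δ] in
/-- The torus coordinates are fixed. [folklore] -/
@[simp] theorem tvMap_iy (w : β ⊕ (γ ⊕ δ) → ℂ) (j : β) : tvMap b₁ b₂ w (iy j) = w (iy j) := by
  simp [tvMap]

omit [Fintype β] [Fintype γ] [Fintype δ] in
/-- The fibre coordinates are fixed. [folklore] -/
@[simp] theorem tvMap_is (w : β ⊕ (γ ⊕ δ) → ℂ) (e : δ) : tvMap b₁ b₂ w (is e) = w (is e) := by
  simp [tvMap]

omit [Fintype β] [Fintype γ] [Fintype δ] in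
/-- The torus factor is unchanged. [folklore] -/
theorem thetaT_tvMap (a : Option β) (w : β ⊕ (γ ⊕ δ) → ℂ) :
    thetaT (γ := γ) (δ := δ) a (tvMap b₁ b₂ w) = thetaT a w := by
  cases a <;> simp [thetaT]

/-! ### Values of the theta functions: source charts `K⟨i,i'⟩`, target point -/

section Values

variable (w : β ⊕ (γ ⊕ δ) → ℂ)

/-- Abbreviation: the rest products `∏_{b ∉ {b₁,b₂}} P_{M b}(z'_b)`. [folklore] -/
def restP (M : γ → Fin 3) (w : β ⊕ (γ ⊕ δ) → ℂ) : ℂ := ∏ b ∈ rest b₁ b₂, L.univExtP (M b) (w (iz b))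

/-- Abbreviation: rest products with one more block removed. [folklore] -/
def restP' (M : γ → Fin 3) (b : γ) (w : β ⊕ (γ ⊕ δ) → ℂ) : ℂ :=
  ∏ b' ∈ (rest b₁ b₂).erase b, L.univExtP (M b') (w (iz b'))

omit [Fintype β] [Fintype δ] in
include h12 in
/-- `Θ^P_{(K⟨i,i'⟩,∅)}(w) = P_i(z₁) P_{i'}(z₂) · restP K`. [folklore] -/
theorem thetaPnone_upd2 (K : γ → Fin 3) (i i' : Fin 3) :
    thetaPnone (β := β) (δ := δ) L (upd2 b₁ b₂ K i i') w =
      L.univExtP i (w (iz b₁)) * L.univExtP i' (w (iz b₂)) * restP (b₁ := b₁) (b₂ := b₂) L K w := by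
  unfold thetaPnone restP
  exact prod_upd2 h12 (fun b j => L.univExtP j (w (iz b))) K i i'

omit [Fintype β] [Fintype δ] in
include h12 in
/-- `Θ^P_{(M,∅)}(w) = P_{M b₁}(z₁) P_{M b₂}(z₂) · restP M`. [folklore] -/
theorem thetaPnone_split (M : γ → Fin 3) :
    thetaPnone (β := β) (δ := δ) L M w =
      L.univExtP (M b₁) (w (iz b₁)) * L.univExtP (M b₂) (w (iz b₂)) * restP (b₁ := b₁) (b₂ := b₂) L M w := by
  rw [← thetaPnone_upd2 L h12 w M (M b₁) (M b₂), upd2_self h12]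

/-- Abbreviation: the companion sum over the rest,
`∑_{b ∉ {b₁,b₂}} κ_{eb} Z_{M b}(z'_b) ∏_{b' ∉ {b₁,b₂,b}} P_{M b'}(z'_{b'})`. [folklore] -/
def restS (M : γ → Fin 3) (e : δ) (w : β ⊕ (γ ⊕ δ) → ℂ) : ℂ :=
  ∑ b ∈ rest b₁ b₂, (κM e b : ℂ) * (L.univExtZ (M b) (w (iz b)) * restP' (b₁ := b₁) (b₂ := b₂) L M b w)

omit [Fintype β] [Fintype δ] in
include h12 in
/-- **The companion sum of `Θ^P_{(M,e)}(w)` split at `b₁, b₂`.** [folklore] -/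
theorem thetaPsome_split (M : γ → Fin 3) (e : δ) :
    thetaPsome (β := β) L κM M e w =
      w (is e) * (L.univExtP (M b₁) (w (iz b₁)) * L.univExtP (M b₂) (w (iz b₂)) * restP (b₁ := b₁) (b₂ := b₂) L M w) -
      ((κM e b₁ : ℂ) * (L.univExtZ (M b₁) (w (iz b₁)) * (L.univExtP (M b₂) (w (iz b₂)) * restP (b₁ := b₁) (b₂ := b₂) L M w)) +
        (κM e b₂ : ℂ) * (L.univExtZ (M b₂) (w (iz b₂)) * (L.univExtP (M b₁) (w (iz b₁)) * restP (b₁ := b₁) (b₂ := b₂) L M w)) +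
        L.univExtP (M b₁) (w (iz b₁)) * L.univExtP (M b₂) (w (iz b₂)) * restS (b₁ := b₁) (b₂ := b₂) L κM M e w) := by
  unfold thetaPsome restS
  rw [thetaPnone_split L h12 w M, sum_split2 h12, Finset.mul_sum]
  congr 2
  · congr 2
    · rw [prod_erase_fst h12]; rfl
    · rw [prod_erase_snd h12]; rfl
  · refine Finset.sum_congr rfl fun b hb => ?_
    rw [prod_erase_of_mem_rest h12 _ hb]
    unfold restP'
    ring

omit [Fintype β] [Fintype δ] in
/-- The rest products of the new point are those of the old one. [folklore] -/
theorem restP_tvMap (M : γ → Fin 3) :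
    restP (b₁ := b₁) (b₂ := b₂) L M (tvMap b₁ b₂ w) = restP (b₁ := b₁) (b₂ := b₂) L M w := by
  unfold restP
  exact Finset.prod_congr rfl fun b hb => by rw [tvMap_iz_of_ne (mem_rest_iff.mp hb).1]

omit [Fintype β] [Fintype δ] in
/-- The same with one more block removed. [folklore] -/
theorem restP'_tvMap (M : γ → Fin 3) (b : γ) :
    restP' (b₁ := b₁) (b₂ := b₂) L M b (tvMap b₁ b₂ w) = restP' (b₁ := b₁) (b₂ := b₂) L M b w := by
  unfold restP'
  exact Finset.prod_congr rfl fun b' hb' => by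
    rw [tvMap_iz_of_ne (mem_rest_iff.mp (Finset.mem_of_mem_erase hb')).1]

omit [Fintype β] [Fintype δ] in
include h12 in
/-- **`Θ^P_{(N,∅)}` at the new point**: `P_{N b₁}(z₁ + z₂) P_{N b₂}(z₂) · restP N`. [folklore] -/
theorem thetaPnone_tvMap (N : γ → Fin 3) :
    thetaPnone (β := β) (δ := δ) L N (tvMap b₁ b₂ w) =
      L.univExtP (N b₁) (w (iz b₁) + w (iz b₂)) * L.univExtP (N b₂) (w (iz b₂)) * restP (b₁ := b₁) (b₂ := b₂) L N w := by
  rw [thetaPnone_split L h12 _ N, restP_tvMap L, tvMap_iz_fst, tvMap_iz_of_ne h12.symm]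

omit [Fintype β] [Fintype δ] in
/-- The rest companion sums of the new point are those of the old one. [folklore] -/
theorem restS_tvMap (M : γ → Fin 3) (e : δ) :
    restS (b₁ := b₁) (b₂ := b₂) L κM M e (tvMap b₁ b₂ w) = restS (b₁ := b₁) (b₂ := b₂) L κM M e w := by
  unfold restS
  exact Finset.sum_congr rfl fun b hb => by
    rw [restP'_tvMap L, tvMap_iz_of_ne (mem_rest_iff.mp hb).1]

omit [Fintype β] [Fintype δ] in
/-- The rest companion sums do not see the change of `κ` at `b₂`. [folklore] -/
theorem restS_tvKappa (M : γ → Fin 3) (e : δ) :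
    restS (b₁ := b₁) (b₂ := b₂) L (tvKappa κM b₁ b₂) M e w = restS (b₁ := b₁) (b₂ := b₂) L κM M e w := by
  unfold restS
  exact Finset.sum_congr rfl fun b hb => by
    have hk : ((tvKappa κM b₁ b₂ e b : Kbar) : ℂ) = κM e b := by simp [tvKappa, (mem_rest_iff.mp hb).2]
    rw [hk]

omit [Fintype β] [Fintype δ] in
include h12 in
/-- **`Θ^P_{(N,e)}` at the new point, for the new `κ`.** [folklore] -/
theorem thetaPsome_tvMap (N : γ → Fin 3) (e : δ) :
    thetaPsome (β := β) L (tvKappa κM b₁ b₂) N e (tvMap b₁ b₂ w) =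
      w (is e) * (L.univExtP (N b₁) (w (iz b₁) + w (iz b₂)) * L.univExtP (N b₂) (w (iz b₂)) * restP (b₁ := b₁) (b₂ := b₂) L N w) -
      ((κM e b₁ : ℂ) * (L.univExtZ (N b₁) (w (iz b₁) + w (iz b₂)) * (L.univExtP (N b₂) (w (iz b₂)) * restP (b₁ := b₁) (b₂ := b₂) L N w)) +
        ((κM e b₂ : ℂ) - (κM e b₁ : ℂ)) * (L.univExtZ (N b₂) (w (iz b₂)) *
          (L.univExtP (N b₁) (w (iz b₁) + w (iz b₂)) * restP (b₁ := b₁) (b₂ := b₂) L N w)) +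
        L.univExtP (N b₁) (w (iz b₁) + w (iz b₂)) * L.univExtP (N b₂) (w (iz b₂)) * restS (b₁ := b₁) (b₂ := b₂) L κM N e w) := by
  rw [thetaPsome_split L (tvKappa κM b₁ b₂) h12 _ N e, restP_tvMap L, restS_tvMap L _,
    restS_tvKappa L κM, tvMap_iz_fst, tvMap_iz_of_ne h12.symm, tvMap_is]
  have hk1 : ((tvKappa κM b₁ b₂ e b₁ : Kbar) : ℂ) = κM e b₁ := by simp [tvKappa, h12]
  have hk2 : ((tvKappa κM b₁ b₂ e b₂ : Kbar) : ℂ) = (κM e b₂ : ℂ) - κM e b₁ := by simp [tvKappa]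
  rw [hk1, hk2]

end Values

end Std

end GaGmE

/-! ### The block relations as quadratic forms, and the transvection identity -/

/-- The coefficient table of the block relations: `ρ_{jk}(x) = ∑_{r,t} ρ₂(j,k;r,t) x_r x_t`.
[folklore] -/
def _root_.PeriodPair.blockRel₂ (j k r t : Fin 3) : ℂ :=
  if j = 0 ∧ k = 2 then (if r = 1 ∧ t = 1 then 2 else 0) else
  if j = 2 ∧ k = 0 then (if r = 1 ∧ t = 1 then -2 else 0) else
  if j = 1 ∧ k = 2 then
    (if r = 2 ∧ t = 2 then 1 / 2 else if r = 0 ∧ t = 1 then L.g₂ / 2 else if r = 0 ∧ t = 0 then L.g₃ / 2 else 0) else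
  if j = 2 ∧ k = 1 then
    (if r = 2 ∧ t = 2 then -(1 / 2) else if r = 0 ∧ t = 1 then -(L.g₂ / 2) else
      if r = 0 ∧ t = 0 then -(L.g₃ / 2) else 0) else 0

/-- Expansion of the block relations. [folklore] -/
theorem _root_.PeriodPair.blockRel_eq_sum (j k : Fin 3) (x : Fin 3 → ℂ) :
    L.blockRel j k x = ∑ r : Fin 3, ∑ t : Fin 3, L.blockRel₂ j k r t * (x r * x t) := by
  have hj : j = 0 ∨ j = 1 ∨ j = 2 := by fin_cases j <;> simp
  have hk : k = 0 ∨ k = 1 ∨ k = 2 := by fin_cases k <;> simp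
  simp only [Fin.sum_univ_three]
  rcases hj with rfl | rfl | rfl <;> rcases hk with rfl | rfl | rfl <;>
    simp +decide only [PeriodPair.blockRel, PeriodPair.blockRel₂, reduceIte] <;> ring

/-- **The transvection identity** (the `κ_{e b₁}`-term of the transvected fibre sections is
PURE): with `p = P(z₁)`, `q = P(z₂)`, `A = A_i(p, q)`,
`B = B_i(q; Z(z₁), p) - B_i(p; Z(z₂), q) + C_i(p, q)` (so `A = μ P_i(z₁+z₂)`, `B = μ Z_i(z₁+z₂)`),
`A Z_{K}(z₁) q_N - B p_K q_N + A p_K Z_N(z₂)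
  = q_N ∑_{jk} α_{jk}(q) p_k ρ_{jK}(p) - p_K ∑_{jk} α_{jk}(p) q_k ρ_{jN}(q) - C_i(p,q) p_K q_N`,
by the antisymmetry `A_i(p, q) = -A_i(q, p)` and the block relations. [folklore] -/
theorem transvection_identity (i K N : Fin 3) (z₁ z₂ : ℂ) :
    L.chordA i (fun j => L.univExtP j z₁) (fun j => L.univExtP j z₂) * L.univExtZ K z₁ * L.univExtP N z₂ -
      (L.chordB i (fun j => L.univExtP j z₂) (fun j => L.univExtZ j z₁) (fun j => L.univExtP j z₁) -
        L.chordB i (fun j => L.univExtP j z₁) (fun j => L.univExtZ j z₂) (fun j => L.univExtP j z₂) +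
        L.chordC i (fun j => L.univExtP j z₁) (fun j => L.univExtP j z₂)) * L.univExtP K z₁ * L.univExtP N z₂ +
      L.chordA i (fun j => L.univExtP j z₁) (fun j => L.univExtP j z₂) * L.univExtP K z₁ * L.univExtZ N z₂ =
    L.univExtP N z₂ * ∑ j : Fin 3, ∑ k : Fin 3, L.chordCoeff i j k (fun j => L.univExtP j z₂) *
        (L.univExtP k z₁ * L.blockRel j K fun l => L.univExtP l z₁) -
      L.univExtP K z₁ * ∑ j : Fin 3, ∑ k : Fin 3, L.chordCoeff i j k (fun j => L.univExtP j z₁) *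
        (L.univExtP k z₂ * L.blockRel j N fun l => L.univExtP l z₂) -
      L.chordC i (fun j => L.univExtP j z₁) (fun j => L.univExtP j z₂) * (L.univExtP K z₁ * L.univExtP N z₂) := by
  have hswap := L.chordA_swap i (fun j => L.univExtP j z₁) (fun j => L.univExtP j z₂)
  have hρp := fun j => L.univExtP_mul_univExtZ_sub j K z₁
  have hρq := fun j => L.univExtP_mul_univExtZ_sub j N z₂
  -- name the atoms
  set p := fun j => L.univExtP j z₁ with hp
  set q := fun j => L.univExtP j z₂ with hq
  set pz := fun j => L.univExtZ j z₁ with hpz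
  set qz := fun j => L.univExtZ j z₂ with hqz
  have hp' : ∀ j, L.univExtP j z₁ = p j := fun j => rfl
  have hq' : ∀ j, L.univExtP j z₂ = q j := fun j => rfl
  have hpz' : ∀ j, L.univExtZ j z₁ = pz j := fun j => rfl
  have hqz' : ∀ j, L.univExtZ j z₂ = qz j := fun j => rfl
  simp only [hp', hq', hpz', hqz'] at hρp hρq ⊢
  -- the first argument of the second `chordA` in `hswap`
  have hA1 : L.chordA i p q = ∑ j : Fin 3, ∑ k : Fin 3, L.chordCoeff i j k q * (p j * p k) := rfl
  have hA2 : L.chordA i q p = ∑ j : Fin 3, ∑ k : Fin 3, L.chordCoeff i j k p * (q j * q k) := rfl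
  have hB1 : L.chordB i q pz p = ∑ j : Fin 3, ∑ k : Fin 3, L.chordCoeff i j k q * (pz j * p k) := rfl
  have hB2 : L.chordB i p qz q = ∑ j : Fin 3, ∑ k : Fin 3, L.chordCoeff i j k p * (qz j * q k) := rfl
  -- split the uses of `A`: through `hA1` for the `Z_K(z₁)`-term, through `hswap`/`hA2` for the `Z_N(z₂)`-term
  have key : L.chordA i p q * pz K * q N - (L.chordB i q pz p - L.chordB i p qz q + L.chordC i p q) * p K * q N +
      L.chordA i p q * p K * qz N =
      q N * ∑ j : Fin 3, ∑ k : Fin 3, L.chordCoeff i j k q * (p k * (p j * pz K - pz j * p K)) +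
      p K * ∑ j : Fin 3, ∑ k : Fin 3, L.chordCoeff i j k p * (q k * (qz j * q N - q j * qz N)) -
      L.chordC i p q * (p K * q N) := by
    have e1 : L.chordA i p q * pz K * q N - L.chordB i q pz p * p K * q N =
        q N * ∑ j : Fin 3, ∑ k : Fin 3, L.chordCoeff i j k q * (p k * (p j * pz K - pz j * p K)) := by
      rw [hA1, hB1]
      simp only [Finset.sum_mul, Finset.mul_sum]
      rw [← Finset.sum_sub_distrib]
      refine Finset.sum_congr rfl fun j _ => ?_
      rw [← Finset.sum_sub_distrib]
      refine Finset.sum_congr rfl fun k _ => ?_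
      ring
    have e2 : L.chordB i p qz q * p K * q N + L.chordA i p q * p K * qz N =
        p K * ∑ j : Fin 3, ∑ k : Fin 3, L.chordCoeff i j k p * (q k * (qz j * q N - q j * qz N)) := by
      have hswap' : L.chordA i p q = -L.chordA i q p := by
        rw [eq_neg_iff_add_eq_zero, add_comm, ← eq_neg_iff_add_eq_zero]
        simpa using hswap
      rw [hswap', hA2, hB2]
      simp only [Finset.sum_mul, Finset.mul_sum, neg_mul]
      rw [← sub_eq_add_neg, ← Finset.sum_sub_distrib]
      refine Finset.sum_congr rfl fun j _ => ?_
      rw [← Finset.sum_sub_distrib]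
      refine Finset.sum_congr rfl fun k _ => ?_
      ring
    linear_combination e1 + e2
  rw [key]
  have e3 : ∑ j : Fin 3, ∑ k : Fin 3, L.chordCoeff i j k q * (p k * (p j * pz K - pz j * p K)) =
      ∑ j : Fin 3, ∑ k : Fin 3, L.chordCoeff i j k q * (p k * L.blockRel j K p) :=
    Finset.sum_congr rfl fun j _ => Finset.sum_congr rfl fun k _ => by rw [hρp j]
  have e4 : ∑ j : Fin 3, ∑ k : Fin 3, L.chordCoeff i j k p * (q k * (qz j * q N - q j * qz N)) =
      -∑ j : Fin 3, ∑ k : Fin 3, L.chordCoeff i j k p * (q k * L.blockRel j N q) := by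
    rw [← Finset.sum_neg_distrib]
    refine Finset.sum_congr rfl fun j _ => ?_
    rw [← Finset.sum_neg_distrib]
    refine Finset.sum_congr rfl fun k _ => ?_
    rw [← hρq j]
    ring
  rw [e3, e4]
  ring

namespace GaGmE

namespace Std

variable {β γ δ : Type} [Fintype β] [Fintype γ] [Fintype δ] [DecidableEq γ]
variable (κM : δ → γ → Kbar) {b₁ b₂ : γ} (h12 : b₁ ≠ b₂)



/-! ### A chart of non-vanishing blocks at a point -/

omit [Fintype β] [Fintype γ] [Fintype δ] [DecidableEq γ] in
/-- At every point some chart has all its blocks non-zero (`2` on the lattice, `0` off it). [folklore] -/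
theorem exists_blocks_ne_zero (w : β ⊕ (γ ⊕ δ) → ℂ) :
    ∃ K : γ → Fin 3, ∀ b, L.univExtP (K b) (w (iz b)) ≠ 0 := by
  classical
  refine ⟨fun b => if w (iz b) ∈ L.lattice then 2 else 0, fun b => ?_⟩
  by_cases hb : w (iz b) ∈ L.lattice
  · obtain ⟨m', n', hmn⟩ := PeriodPair.mem_lattice.mp hb
    obtain ⟨c, hc, -, -, h2, -⟩ := L.exists_univExtTheta_lattice m' n' 0
    simp only [PeriodPair.univExtTheta_inl] at h2
    have h2c : (if w (iz b) ∈ L.lattice then (2 : Fin 3) else 0) = 2 := if_pos hb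
    show L.univExtP (if w (iz b) ∈ L.lattice then (2 : Fin 3) else 0) (w (iz b)) ≠ 0
    rw [h2c, ← hmn, h2]
    exact mul_ne_zero hc (by norm_num)
  · have h0 : (if w (iz b) ∈ L.lattice then (2 : Fin 3) else 0) = 0 := if_neg hb
    show L.univExtP (if w (iz b) ∈ L.lattice then (2 : Fin 3) else 0) (w (iz b)) ≠ 0
    rw [h0, (PeriodPair.univExtP_eq hb).1]
    exact pow_ne_zero _ (L.weierstrassSigma_ne_zero hb)

/-! ### The forms -/

section Forms

variable (b₁ b₂ : γ) (K : γ → Fin 3)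

/-- **The main part**: `∑ a^{(N b₁)}_{jk;lm} X_{(a,(Ñ,o))} X_{(∅,(K⟨j,l⟩,∅))} X_{(∅,(K⟨k,m⟩,∅))}`,
`Ñ = N[b₁ ↦ K b₁]`. [folklore] -/
def tvMain (a : Option β) (N : γ → Fin 3) (o : Option δ) : MvPolynomial (Option β × ThetaIdx γ δ) ℂ :=
  ∑ j : Fin 3, ∑ k : Fin 3, ∑ l : Fin 3, ∑ m : Fin 3,
    C (L.chordCoeff₂ (N b₁) j k l m) *
      (X (a, (upd2 b₁ b₂ N (K b₁) (N b₂), o)) *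
        (X (none, (upd2 b₁ b₂ K j l, none)) * X (none, (upd2 b₁ b₂ K k m, none))))

/-- First group of the pure correction: `q_{N₂} ∑ α_{jk}(q) p_k ρ_{jK₁}(p)`. [folklore] -/
def tvCorr₁ (a : Option β) (N : γ → Fin 3) : MvPolynomial (Option β × ThetaIdx γ δ) ℂ :=
  ∑ j : Fin 3, ∑ k : Fin 3, ∑ r : Fin 3, ∑ t : Fin 3, ∑ l : Fin 3, ∑ m : Fin 3,
    C (L.chordCoeff₂ (N b₁) j k l m * L.blockRel₂ j (K b₁) r t) *
      (X (a, (upd2 b₁ b₂ N t (N b₂), none)) *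
        (X (none, (upd2 b₁ b₂ K k l, none)) * X (none, (upd2 b₁ b₂ K r m, none))))

/-- Second group of the pure correction: `p_{K₁} ∑ α_{jk}(p) q_k ρ_{jN₂}(q)`. [folklore] -/
def tvCorr₂ (a : Option β) (N : γ → Fin 3) : MvPolynomial (Option β × ThetaIdx γ δ) ℂ :=
  ∑ j : Fin 3, ∑ k : Fin 3, ∑ r : Fin 3, ∑ t : Fin 3, ∑ l : Fin 3, ∑ m : Fin 3,
    C (L.chordCoeff₂ (N b₁) j k l m * L.blockRel₂ j (N b₂) r t) *
      (X (a, (upd2 b₁ b₂ N (K b₁) k, none)) *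
        (X (none, (upd2 b₁ b₂ K l r, none)) * X (none, (upd2 b₁ b₂ K m t, none))))

/-- Third group of the pure correction: `C(p, q) p_{K₁} q_{N₂}`. [folklore] -/
def tvCorr₃ (a : Option β) (N : γ → Fin 3) : MvPolynomial (Option β × ThetaIdx γ δ) ℂ :=
  ∑ l : Fin 3, ∑ m : Fin 3, ∑ l' : Fin 3, ∑ m' : Fin 3,
    C (L.chordC₂ (N b₁) l m l' m') *
      (X (a, (upd2 b₁ b₂ N (K b₁) (N b₂), none)) *
        (X (none, (upd2 b₁ b₂ K l l', none)) * X (none, (upd2 b₁ b₂ K m m', none))))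

/-- **The pure correction** (the three groups of `transvection_identity`). [folklore] -/
def tvCorr (a : Option β) (N : γ → Fin 3) : MvPolynomial (Option β × ThetaIdx γ δ) ℂ :=
  tvCorr₁ L b₁ b₂ K a N - tvCorr₂ L b₁ b₂ K a N - tvCorr₃ L b₁ b₂ K a N

/-- **The forms representing the transvection** at the chart `K`. [folklore] -/
def tvForm (a : Option β) (N : γ → Fin 3) : Option δ → MvPolynomial (Option β × ThetaIdx γ δ) ℂ
  | none => tvMain L b₁ b₂ K a N none
  | some e => tvMain L b₁ b₂ K a N (some e) + C (κM e b₁ : ℂ) * tvCorr L b₁ b₂ K a N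

/-- **The unit** `u = -σ(z₁ - z₂)³ · P_{K b₁}(z₁) · (∏_{rest} P_{K b}(z_b))²`. [folklore] -/
def tvUnit (w : β ⊕ (γ ⊕ δ) → ℂ) : ℂ :=
  -(L.weierstrassSigma (w (iz b₁) - w (iz b₂)) ^ 3) * L.univExtP (K b₁) (w (iz b₁)) *
    restP (b₁ := b₁) (b₂ := b₂) L K w ^ 2

omit [Fintype β] [Fintype γ] [Fintype δ] [DecidableEq γ] in
/-- A cubic monomial with a constant is a cubic form. [folklore] -/
theorem isHomogeneous_CXXX (c : ℂ) (J₁ J₂ J₃ : Option β × ThetaIdx γ δ) :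
    (C c * (X J₁ * (X J₂ * X J₃)) : MvPolynomial (Option β × ThetaIdx γ δ) ℂ).IsHomogeneous 3 := by
  simpa using ((isHomogeneous_X ℂ J₁).mul ((isHomogeneous_X ℂ J₂).mul (isHomogeneous_X ℂ J₃))).C_mul c

omit [Fintype β] [Fintype γ] [Fintype δ] in
/-- The main part is a cubic form. [folklore] -/
theorem tvMain_isHomogeneous (a : Option β) (N : γ → Fin 3) (o : Option δ) :
    (tvMain L b₁ b₂ K a N o).IsHomogeneous 3 :=
  IsHomogeneous.sum _ _ _ fun _ _ => IsHomogeneous.sum _ _ _ fun _ _ =>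
    IsHomogeneous.sum _ _ _ fun _ _ => IsHomogeneous.sum _ _ _ fun _ _ => isHomogeneous_CXXX _ _ _ _

omit [Fintype β] [Fintype γ] [Fintype δ] in
/-- The correction is a cubic form. [folklore] -/
theorem tvCorr_isHomogeneous (a : Option β) (N : γ → Fin 3) :
    (tvCorr (δ := δ) L b₁ b₂ K a N).IsHomogeneous 3 := by
  have h6 : ∀ (c : Fin 3 → Fin 3 → Fin 3 → Fin 3 → Fin 3 → Fin 3 → ℂ)
      (J₁ J₂ J₃ : Fin 3 → Fin 3 → Fin 3 → Fin 3 → Fin 3 → Fin 3 → Option β × ThetaIdx γ δ),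
      (∑ j : Fin 3, ∑ k : Fin 3, ∑ l : Fin 3, ∑ m : Fin 3, ∑ r : Fin 3, ∑ t : Fin 3,
        C (c j k l m r t) * (X (J₁ j k l m r t) * (X (J₂ j k l m r t) * X (J₃ j k l m r t))) :
          MvPolynomial (Option β × ThetaIdx γ δ) ℂ).IsHomogeneous 3 := fun c J₁ J₂ J₃ =>
    IsHomogeneous.sum _ _ _ fun _ _ => IsHomogeneous.sum _ _ _ fun _ _ =>
      IsHomogeneous.sum _ _ _ fun _ _ => IsHomogeneous.sum _ _ _ fun _ _ =>
      IsHomogeneous.sum _ _ _ fun _ _ => IsHomogeneous.sum _ _ _ fun _ _ => isHomogeneous_CXXX _ _ _ _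
  have h4 : ∀ (c : Fin 3 → Fin 3 → Fin 3 → Fin 3 → ℂ)
      (J₁ J₂ J₃ : Fin 3 → Fin 3 → Fin 3 → Fin 3 → Option β × ThetaIdx γ δ),
      (∑ j : Fin 3, ∑ k : Fin 3, ∑ l : Fin 3, ∑ m : Fin 3,
        C (c j k l m) * (X (J₁ j k l m) * (X (J₂ j k l m) * X (J₃ j k l m))) :
          MvPolynomial (Option β × ThetaIdx γ δ) ℂ).IsHomogeneous 3 := fun c J₁ J₂ J₃ =>
    IsHomogeneous.sum _ _ _ fun _ _ => IsHomogeneous.sum _ _ _ fun _ _ =>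
      IsHomogeneous.sum _ _ _ fun _ _ => IsHomogeneous.sum _ _ _ fun _ _ => isHomogeneous_CXXX _ _ _ _
  exact ((h6 _ _ _ _).sub (h6 _ _ _ _)).sub (h4 _ _ _ _)

omit [Fintype β] [Fintype γ] [Fintype δ] in
/-- The representing forms are cubic. [folklore] -/
theorem tvForm_isHomogeneous (a : Option β) (N : γ → Fin 3) (o : Option δ) :
    (tvForm L κM b₁ b₂ K a N o).IsHomogeneous 3 := by
  cases o with
  | none => exact tvMain_isHomogeneous L b₁ b₂ K a N none
  | some e =>
    exact (tvMain_isHomogeneous L b₁ b₂ K a N (some e)).add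
      ((tvCorr_isHomogeneous (δ := δ) L b₁ b₂ K a N).C_mul (κM e b₁ : ℂ))

end Forms

/-! ### Evaluation of the forms -/

section Eval

variable (K : γ → Fin 3) (w : β ⊕ (γ ⊕ δ) → ℂ)

omit [Fintype β] [Fintype δ] in
/-- The rest products of `M⟨i,i'⟩` are those of `M`. [folklore] -/
theorem restP_upd2 (M : γ → Fin 3) (i i' : Fin 3) :
    restP (b₁ := b₁) (b₂ := b₂) L (upd2 b₁ b₂ M i i') w = restP (b₁ := b₁) (b₂ := b₂) L M w :=
  Finset.prod_congr rfl fun b hb => by rw [upd2_of_mem_rest M i i' hb]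

omit [Fintype β] [Fintype δ] in
/-- The same with one more block removed. [folklore] -/
theorem restP'_upd2 (M : γ → Fin 3) (i i' : Fin 3) (b : γ) :
    restP' (b₁ := b₁) (b₂ := b₂) L (upd2 b₁ b₂ M i i') b w = restP' (b₁ := b₁) (b₂ := b₂) L M b w :=
  Finset.prod_congr rfl fun b' hb' => by rw [upd2_of_mem_rest M i i' (Finset.mem_of_mem_erase hb')]

omit [Fintype β] [Fintype δ] in
/-- The rest companion sums of `M⟨i,i'⟩` are those of `M`. [folklore] -/
theorem restS_upd2 (M : γ → Fin 3) (e : δ) (i i' : Fin 3) :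
    restS (b₁ := b₁) (b₂ := b₂) L κM (upd2 b₁ b₂ M i i') e w = restS (b₁ := b₁) (b₂ := b₂) L κM M e w :=
  Finset.sum_congr rfl fun b hb => by rw [upd2_of_mem_rest M i i' hb, restP'_upd2]

omit [Fintype β] [Fintype δ] in
include h12 in
/-- `Θ_{(a,(M⟨i,i'⟩,∅))}(w) = T_a · P_i(z₁) P_{i'}(z₂) · restP M`. [folklore] -/
theorem thetaEval_X_upd2_none (a : Option β) (M : γ → Fin 3) (i i' : Fin 3) :
    thetaEval L κM (X (a, (upd2 b₁ b₂ M i i', none))) w =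
      thetaT (γ := γ) (δ := δ) a w *
        (L.univExtP i (w (iz b₁)) * L.univExtP i' (w (iz b₂)) * restP (b₁ := b₁) (b₂ := b₂) L M w) := by
  rw [thetaEval_X, theta, thetaP_none, thetaPnone_upd2 L h12]

omit [Fintype β] [Fintype δ] in
include h12 in
/-- **Evaluation of the main part**: `Θ_{(a,(Ñ,o))}(w) · restP K² · A_{N b₁}(P(z₁), P(z₂))`. [folklore] -/
theorem thetaEval_tvMain (a : Option β) (N : γ → Fin 3) (o : Option δ) :
    thetaEval L κM (tvMain L b₁ b₂ K a N o) w =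
      theta L κM (a, (upd2 b₁ b₂ N (K b₁) (N b₂), o)) w * restP (b₁ := b₁) (b₂ := b₂) L K w ^ 2 *
        L.chordA (N b₁) (fun j => L.univExtP j (w (iz b₁))) (fun j => L.univExtP j (w (iz b₂))) := by
  have hX : ∀ i i' : Fin 3, theta L κM (none, (upd2 b₁ b₂ K i i', none)) w =
      L.univExtP i (w (iz b₁)) * L.univExtP i' (w (iz b₂)) * restP (b₁ := b₁) (b₂ := b₂) L K w := by
    intro i i'
    have := thetaEval_X_upd2_none L κM h12 w none K i i'
    simpa [thetaEval] using this
  unfold tvMain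
  simp only [thetaEval, map_sum, map_mul, eval_C, eval_X, hX]
  rw [PeriodPair.chordA]
  simp only [L.chordCoeff_eq_sum, Finset.sum_mul, Finset.mul_sum]
  refine Finset.sum_congr rfl fun j _ => Finset.sum_congr rfl fun k _ =>
    Finset.sum_congr rfl fun l _ => Finset.sum_congr rfl fun m _ => ?_
  ring

omit [Fintype β] [Fintype δ] in
include h12 in
/-- Values of the padded coordinates `X_{(a,(M⟨i,i'⟩,∅))}`. [folklore] -/
theorem theta_upd2_none (a : Option β) (M : γ → Fin 3) (i i' : Fin 3) :
    theta L κM (a, (upd2 b₁ b₂ M i i', none)) w =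
      thetaT (γ := γ) (δ := δ) a w *
        (L.univExtP i (w (iz b₁)) * L.univExtP i' (w (iz b₂)) * restP (b₁ := b₁) (b₂ := b₂) L M w) := by
  have := thetaEval_X_upd2_none L κM h12 w a M i i'
  simpa [thetaEval] using this

set_option maxHeartbeats 800000 in
omit [Fintype β] [Fintype δ] in
include h12 in
/-- Evaluation of the first group. [folklore] -/
theorem thetaEval_tvCorr₁ (a : Option β) (N : γ → Fin 3) :
    thetaEval L κM (tvCorr₁ L b₁ b₂ K a N) w =
      thetaT (γ := γ) (δ := δ) a w * restP (b₁ := b₁) (b₂ := b₂) L N w * restP (b₁ := b₁) (b₂ := b₂) L K w ^ 2 *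
      (L.univExtP (N b₂) (w (iz b₂)) * ∑ j : Fin 3, ∑ k : Fin 3,
          L.chordCoeff (N b₁) j k (fun j => L.univExtP j (w (iz b₂))) *
            (L.univExtP k (w (iz b₁)) * L.blockRel j (K b₁) fun l => L.univExtP l (w (iz b₁)))) := by
  unfold tvCorr₁
  simp only [thetaEval, map_sum, map_mul, eval_C, eval_X, theta_upd2_none L κM h12 w, thetaT_none, one_mul]
  simp only [L.chordCoeff_eq_sum, L.blockRel_eq_sum, Finset.sum_mul, Finset.mul_sum]
  refine Finset.sum_congr rfl fun j _ => Finset.sum_congr rfl fun k _ =>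
    Finset.sum_congr rfl fun l _ => Finset.sum_congr rfl fun m _ =>
    Finset.sum_congr rfl fun r _ => Finset.sum_congr rfl fun t _ => ?_
  ring

set_option maxHeartbeats 800000 in
omit [Fintype β] [Fintype δ] in
include h12 in
/-- Evaluation of the second group. [folklore] -/
theorem thetaEval_tvCorr₂ (a : Option β) (N : γ → Fin 3) :
    thetaEval L κM (tvCorr₂ L b₁ b₂ K a N) w =
      thetaT (γ := γ) (δ := δ) a w * restP (b₁ := b₁) (b₂ := b₂) L N w * restP (b₁ := b₁) (b₂ := b₂) L K w ^ 2 *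
      (L.univExtP (K b₁) (w (iz b₁)) * ∑ j : Fin 3, ∑ k : Fin 3,
          L.chordCoeff (N b₁) j k (fun j => L.univExtP j (w (iz b₁))) *
            (L.univExtP k (w (iz b₂)) * L.blockRel j (N b₂) fun l => L.univExtP l (w (iz b₂)))) := by
  unfold tvCorr₂
  simp only [thetaEval, map_sum, map_mul, eval_C, eval_X, theta_upd2_none L κM h12 w, thetaT_none, one_mul]
  simp only [L.chordCoeff_eq_sum, L.blockRel_eq_sum, Finset.sum_mul, Finset.mul_sum]
  refine Finset.sum_congr rfl fun j _ => Finset.sum_congr rfl fun k _ =>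
    Finset.sum_congr rfl fun l _ => Finset.sum_congr rfl fun m _ =>
    Finset.sum_congr rfl fun r _ => Finset.sum_congr rfl fun t _ => ?_
  ring

set_option maxHeartbeats 800000 in
omit [Fintype β] [Fintype δ] in
include h12 in
/-- Evaluation of the third group. [folklore] -/
theorem thetaEval_tvCorr₃ (a : Option β) (N : γ → Fin 3) :
    thetaEval L κM (tvCorr₃ L b₁ b₂ K a N) w =
      thetaT (γ := γ) (δ := δ) a w * restP (b₁ := b₁) (b₂ := b₂) L N w * restP (b₁ := b₁) (b₂ := b₂) L K w ^ 2 *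
      (L.chordC (N b₁) (fun j => L.univExtP j (w (iz b₁))) (fun j => L.univExtP j (w (iz b₂))) *
        (L.univExtP (K b₁) (w (iz b₁)) * L.univExtP (N b₂) (w (iz b₂)))) := by
  unfold tvCorr₃
  simp only [thetaEval, map_sum, map_mul, eval_C, eval_X, theta_upd2_none L κM h12 w, thetaT_none, one_mul]
  rw [PeriodPair.chordC_eq_sum]
  simp only [PeriodPair.chordCcoeff, Finset.sum_mul, Finset.mul_sum]
  refine Finset.sum_congr rfl fun l _ => Finset.sum_congr rfl fun m _ =>
    Finset.sum_congr rfl fun l' _ => Finset.sum_congr rfl fun m' _ => ?_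
  ring

omit [Fintype β] [Fintype δ] in
include h12 in
/-- **Evaluation of the correction**: `T_a · restP N · restP K² ·` (the pure side of
`transvection_identity`). [folklore] -/
theorem thetaEval_tvCorr (a : Option β) (N : γ → Fin 3) :
    thetaEval L κM (tvCorr L b₁ b₂ K a N) w =
      thetaT (γ := γ) (δ := δ) a w * restP (b₁ := b₁) (b₂ := b₂) L N w * restP (b₁ := b₁) (b₂ := b₂) L K w ^ 2 *
      (L.univExtP (N b₂) (w (iz b₂)) * ∑ j : Fin 3, ∑ k : Fin 3,
          L.chordCoeff (N b₁) j k (fun j => L.univExtP j (w (iz b₂))) *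
            (L.univExtP k (w (iz b₁)) * L.blockRel j (K b₁) fun l => L.univExtP l (w (iz b₁))) -
        L.univExtP (K b₁) (w (iz b₁)) * ∑ j : Fin 3, ∑ k : Fin 3,
          L.chordCoeff (N b₁) j k (fun j => L.univExtP j (w (iz b₁))) *
            (L.univExtP k (w (iz b₂)) * L.blockRel j (N b₂) fun l => L.univExtP l (w (iz b₂))) -
        L.chordC (N b₁) (fun j => L.univExtP j (w (iz b₁))) (fun j => L.univExtP j (w (iz b₂))) *
          (L.univExtP (K b₁) (w (iz b₁)) * L.univExtP (N b₂) (w (iz b₂)))) := by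
  unfold tvCorr
  simp only [thetaEval, map_sub]
  change thetaEval L κM (tvCorr₁ L b₁ b₂ K a N) w - thetaEval L κM (tvCorr₂ L b₁ b₂ K a N) w -
    thetaEval L κM (tvCorr₃ L b₁ b₂ K a N) w = _
  rw [thetaEval_tvCorr₁ L κM h12, thetaEval_tvCorr₂ L κM h12, thetaEval_tvCorr₃ L κM h12]
  ring

end Eval

/-! ### The representation off the diagonal -/

section Repr

variable (K : γ → Fin 3) (w : β ⊕ (γ ⊕ δ) → ℂ)

omit [Fintype β] [Fintype δ] in
include h12 in
/-- **`tvForm` represents the transvection on the coordinates `(a,(N,∅))`.** [folklore] -/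
theorem thetaEval_tvForm_none (a : Option β) (N : γ → Fin 3) :
    thetaEval L κM (tvForm L κM b₁ b₂ K a N none) w =
      tvUnit (b₁ := b₁) (b₂ := b₂) L K w * theta L (tvKappa κM b₁ b₂) (a, (N, none)) (tvMap b₁ b₂ w) := by
  simp only [tvForm]
  rw [thetaEval_tvMain L κM h12, theta, thetaP_none, thetaPnone_upd2 L h12, L.chordA_univExtP, theta,
    thetaT_tvMap, thetaP_none, thetaPnone_tvMap L h12, tvUnit]
  ring

set_option maxHeartbeats 800000 in
omit [Fintype β] [Fintype δ] in
include h12 in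
/-- **`tvForm` represents the transvection on the fibre coordinates `(a,(N,e))`** (the heart:
`transvection_identity`). [folklore] -/
theorem thetaEval_tvForm_some (a : Option β) (N : γ → Fin 3) (e : δ) :
    thetaEval L κM (tvForm L κM b₁ b₂ K a N (some e)) w =
      tvUnit (b₁ := b₁) (b₂ := b₂) L K w * theta L (tvKappa κM b₁ b₂) (a, (N, some e)) (tvMap b₁ b₂ w) := by
  have hID := transvection_identity L (N b₁) (K b₁) (N b₂) (w (iz b₁)) (w (iz b₂))
  have hA := L.chordA_univExtP (N b₁) (w (iz b₁)) (w (iz b₂))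
  have hB := L.chord_companion (N b₁) (w (iz b₁)) (w (iz b₂))
  simp only [tvForm]
  rw [thetaEval, map_add, map_mul, eval_C]
  change thetaEval L κM (tvMain L b₁ b₂ K a N (some e)) w +
    (κM e b₁ : ℂ) * thetaEval L κM (tvCorr L b₁ b₂ K a N) w = _
  rw [thetaEval_tvMain L κM h12, thetaEval_tvCorr L κM h12, theta, thetaP_some,
    thetaPsome_split L κM h12 w _ e, upd2_fst, upd2_snd h12, restP_upd2, restS_upd2, theta, thetaT_tvMap,
    thetaP_some, thetaPsome_tvMap L κM h12 w N e, ← hID, hA, hB, tvUnit]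
  ring

omit [Fintype β] [Fintype δ] in
include h12 in
/-- **`tvForm` represents the transvection** (all coordinates). [folklore] -/
theorem thetaEval_tvForm (J : Option β × ThetaIdx γ δ) :
    thetaEval L κM (tvForm L κM b₁ b₂ K J.1 J.2.1 J.2.2) w =
      tvUnit (b₁ := b₁) (b₂ := b₂) L K w * theta L (tvKappa κM b₁ b₂) J (tvMap b₁ b₂ w) := by
  obtain ⟨a, N, _ | e⟩ := J
  · exact thetaEval_tvForm_none L κM h12 K w a N
  · exact thetaEval_tvForm_some L κM h12 K w a N e

end Repr

/-! ### `Θ`-morphic at a point; the transvection is `Θ`-morphic -/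

section Morphic

variable (κM' κM'' : δ → γ → Kbar)

/-- **`Θ`-morphic at the point `w₀`** (one polynomial representation good at `w₀`). [folklore] -/
def IsThetaMorphicAt (Φ : (β ⊕ (γ ⊕ δ) → ℂ) → (β ⊕ (γ ⊕ δ) → ℂ)) (w₀ : β ⊕ (γ ⊕ δ) → ℂ) : Prop :=
  ∃ (d : ℕ) (A : Option β × ThetaIdx γ δ → MvPolynomial (Option β × ThetaIdx γ δ) ℂ)
    (u : (β ⊕ (γ ⊕ δ) → ℂ) → ℂ),
    (∀ J, (A J).IsHomogeneous d) ∧ u w₀ ≠ 0 ∧ ∀ w J, thetaEval L κM (A J) w = u w * theta L κM' J (Φ w)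

omit [Fintype β] [Fintype δ] in
/-- `Θ`-morphic means `Θ`-morphic at every point. [folklore] -/
theorem isThetaMorphic_iff (Φ : (β ⊕ (γ ⊕ δ) → ℂ) → (β ⊕ (γ ⊕ δ) → ℂ)) :
    IsThetaMorphic L κM κM' Φ ↔ ∀ w₀, IsThetaMorphicAt L κM κM' Φ w₀ := Iff.rfl

omit [Fintype β] [Fintype δ] in
/-- Composition at a point. [folklore] -/
theorem IsThetaMorphicAt.comp {Φ Ψ : (β ⊕ (γ ⊕ δ) → ℂ) → (β ⊕ (γ ⊕ δ) → ℂ)} {w₀ : β ⊕ (γ ⊕ δ) → ℂ}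
    (hΨ : IsThetaMorphicAt L κM' κM'' Ψ (Φ w₀)) (hΦ : IsThetaMorphicAt L κM κM' Φ w₀) :
    IsThetaMorphicAt L κM κM'' (fun w => Ψ (Φ w)) w₀ := by
  obtain ⟨d₁, A, u, hA, hu, hAeval⟩ := hΦ
  obtain ⟨d₂, B, v, hB, hv, hBeval⟩ := hΨ
  refine ⟨d₁ * d₂, fun J => bind₁ A (B J), fun w => u w ^ d₂ * v (Φ w), fun J => ?_,
    mul_ne_zero (pow_ne_zero _ hu) hv, fun w J => ?_⟩
  · rw [← aeval_eq_bind₁]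
    exact (hB J).aeval _ hA
  · unfold thetaEval
    rw [eval_bind₁]
    have h : (fun I => eval (fun J' => theta L κM J' w) (A I)) = u w • fun I => theta L κM' I (Φ w) := by
      funext I
      exact hAeval w I
    rw [h, eval_smul_of_isHomogeneous (hB J)]
    change u w ^ d₂ * thetaEval L κM' (B J) (Φ w) = _
    rw [hBeval (Φ w) J, mul_assoc]

omit [Fintype β] [Fintype δ] in
/-- Congruence at a point. [folklore] -/
theorem IsThetaMorphicAt.congr {Φ Ψ : (β ⊕ (γ ⊕ δ) → ℂ) → (β ⊕ (γ ⊕ δ) → ℂ)} {w₀ : β ⊕ (γ ⊕ δ) → ℂ}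
    (hΦ : IsThetaMorphicAt L κM κM' Φ w₀) (h : ∀ w, Φ w = Ψ w) : IsThetaMorphicAt L κM κM' Ψ w₀ := by
  have : Φ = Ψ := funext h
  subst this
  exact hΦ

omit [Fintype β] [Fintype δ] in
include h12 in
/-- **The transvection is `Θ`-morphic at every point off the diagonal `z'_{b₁} ≡ z'_{b₂}`.** [folklore] -/
theorem isThetaMorphicAt_transvection_of_notMem {w₀ : β ⊕ (γ ⊕ δ) → ℂ}
    (hw₀ : w₀ (iz b₁) - w₀ (iz b₂) ∉ L.lattice) :
    IsThetaMorphicAt L κM (tvKappa κM b₁ b₂) (tvMap b₁ b₂) w₀ := by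
  obtain ⟨K, hK⟩ := exists_blocks_ne_zero (β := β) (δ := δ) L w₀
  refine ⟨3, fun J => tvForm L κM b₁ b₂ K J.1 J.2.1 J.2.2, tvUnit (b₁ := b₁) (b₂ := b₂) L K,
    fun J => tvForm_isHomogeneous L κM b₁ b₂ K J.1 J.2.1 J.2.2, ?_, fun w J => thetaEval_tvForm L κM h12 K w J⟩
  refine mul_ne_zero (mul_ne_zero (neg_ne_zero.mpr ((L.sigma_sub_pow_ne_zero_iff _ _).mpr hw₀)) (hK b₁))
    (pow_ne_zero _ (Finset.prod_ne_zero_iff.mpr fun b _ => hK b))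

/-- The auxiliary shift `(c at b₁, -c at b₂)` of the `E`-coordinates. [folklore] -/
def tvShift (b₁ b₂ : γ) (c : ℂ) : β ⊕ (γ ⊕ δ) → ℂ :=
  coords (fun _ => 0) (Pi.single b₁ c - Pi.single b₂ c) fun _ => 0

/-- The shift back `(c at b₂)`. [folklore] -/
def tvShift' (b₂ : γ) (c : ℂ) : β ⊕ (γ ⊕ δ) → ℂ :=
  coords (fun _ => 0) (Pi.single b₂ c) fun _ => 0

omit [Fintype β] [Fintype γ] [Fintype δ] in
include h12 in
/-- **The transvection conjugated by the shifts**: `tv(w + t_c) + t'_c = tv(w)`. [folklore] -/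
theorem tvMap_add_tvShift (c : ℂ) (w : β ⊕ (γ ⊕ δ) → ℂ) :
    tvMap b₁ b₂ (w + tvShift (β := β) (δ := δ) b₁ b₂ c) + tvShift' (β := β) (δ := δ) b₂ c = tvMap b₁ b₂ w := by
  funext k
  rcases k with j | b | e
  · change tvMap b₁ b₂ (w + tvShift b₁ b₂ c) (iy j) + tvShift' b₂ c (iy j) = tvMap b₁ b₂ w (iy j)
    simp [tvShift, tvShift']
  · change tvMap b₁ b₂ (w + tvShift b₁ b₂ c) (iz b) + tvShift' b₂ c (iz b) = tvMap b₁ b₂ w (iz b)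
    by_cases hb : b = b₁
    · subst hb
      simp [tvShift, tvShift', h12, h12.symm]
      ring
    · rw [tvMap_iz_of_ne hb, tvMap_iz_of_ne hb]
      by_cases hb2 : b = b₂
      · subst hb2; simp [tvShift, tvShift', hb]
      · simp [tvShift, tvShift', hb, hb2]
  · change tvMap b₁ b₂ (w + tvShift b₁ b₂ c) (is e) + tvShift' b₂ c (is e) = tvMap b₁ b₂ w (is e)
    simp [tvShift, tvShift']

omit [Fintype β] [Fintype δ] in
include h12 in
/-- **The elementary transvection `z'_{b₁} ↦ z'_{b₁} + z'_{b₂}` is `Θ`-morphic `M_κ → M_{κ'}`**,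
`κ' = tvKappa κ b₁ b₂`. Off the diagonal by the explicit cubic forms; on the diagonal as the
composite translation – transvection at a point off the diagonal – translation.
[cite: NesterenkoPhilippon2001, Ch. 11 §2.1] -/
theorem isThetaMorphic_transvection :
    IsThetaMorphic L κM (tvKappa κM b₁ b₂) (tvMap b₁ b₂ : (β ⊕ (γ ⊕ δ) → ℂ) → (β ⊕ (γ ⊕ δ) → ℂ)) := by
  intro w₀
  by_cases hw₀ : w₀ (iz b₁) - w₀ (iz b₂) ∈ L.lattice
  · obtain ⟨c, hc⟩ := exists_generic_scalar L 2
    have h2c : 2 * c ∉ L.lattice := by simpa using hc 1 one_pos one_lt_two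
    set t := tvShift (β := β) (δ := δ) b₁ b₂ c with ht
    set t' := tvShift' (β := β) (δ := δ) b₂ c with ht'
    have hoff : (w₀ + t) (iz b₁) - (w₀ + t) (iz b₂) ∉ L.lattice := by
      intro hmem
      have heq : (w₀ + t) (iz b₁) - (w₀ + t) (iz b₂) = (w₀ (iz b₁) - w₀ (iz b₂)) + 2 * c := by
        simp [ht, tvShift, h12.symm]
        ring
      rw [heq] at hmem
      exact h2c (by simpa using L.lattice.sub_mem hmem hw₀)
    have h1 : IsThetaMorphicAt L κM κM (fun w => w + t) w₀ := isThetaMorphic_add_const L κM t w₀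
    have h2 : IsThetaMorphicAt L κM (tvKappa κM b₁ b₂) (tvMap b₁ b₂) (w₀ + t) :=
      isThetaMorphicAt_transvection_of_notMem L κM h12 hoff
    have h3 : IsThetaMorphicAt L (tvKappa κM b₁ b₂) (tvKappa κM b₁ b₂) (fun w => w + t')
        (tvMap b₁ b₂ (w₀ + t)) := isThetaMorphic_add_const L (tvKappa κM b₁ b₂) t' _
    have h21 : IsThetaMorphicAt L κM (tvKappa κM b₁ b₂) (fun w => tvMap b₁ b₂ (w + t)) w₀ :=
      IsThetaMorphicAt.comp L κM κM (tvKappa κM b₁ b₂) (Φ := fun w => w + t) (Ψ := tvMap b₁ b₂)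
        (w₀ := w₀) h2 h1
    have h321 : IsThetaMorphicAt L κM (tvKappa κM b₁ b₂) (fun w => tvMap b₁ b₂ (w + t) + t') w₀ :=
      IsThetaMorphicAt.comp L κM (tvKappa κM b₁ b₂) (tvKappa κM b₁ b₂)
        (Φ := fun w => tvMap b₁ b₂ (w + t)) (Ψ := fun w => w + t') (w₀ := w₀) h3 h21
    exact h321.congr L _ _ fun w => tvMap_add_tvShift h12 c w
  · exact isThetaMorphicAt_transvection_of_notMem L κM h12 hw₀

end Morphic


end Std

end GaGmE

end Literature.NumberTheory.Transcendental

end
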